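import Mathlib
import Summits.AtomisticToContinuum.BoseEinsteinCondensation.Theorems.SoloBlindSusceptibilityMoment

/-!
# Thomson (flow) form of the susceptibility bound (paper §12.5)

Solo programme `solo-AtomisticToContinuum-blind`, session 4.

The one-particle zero-frequency susceptibility entering inequality (♣) of §12,
`m₋₁ = ⟪y₊, P₊⁻¹ y₊⟫ + ⟪y₋, P₋⁻¹ y₋⟫`, is an `H⁻¹`-type quantity. When the positive operators
factorise, `P = T† T` — for the Bose gas this is the ground-state (Jastrow/Dirichlet-form)
representation `H_{N±1} − E − c = Σ_j D_j† D_j` with `D_j = Φ ∂_j Φ⁻¹`, `Φ > 0` the `N±1`-particle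
ground state — Thomson's principle gives `⟪y, P⁻¹ y⟫ = inf {‖G‖² : T† G = y}`: every *flow* `G`
solving the divergence constraint `T† G = y` bounds the susceptibility, hence `n_k`, from ABOVE.
This file proves the inequality half abstractly, with no inverse and no solution `z` of `P z = y`
needed:

* `norm_sq_sq_le_form_mul_flow` : `‖y‖⁴ ≤ re ⟪y, P y⟫ · ‖G‖²` whenever `P = T†T` and `T† G = y`;
* `re_inner_le_norm_sq_of_flow` : if moreover `P z = y` then `re ⟪z, y⟫ ≤ ‖G‖²`
  (the flow bounds the susceptibility itself);
* `occupation_flow_bound` : the (♣)-type occupation bound with the susceptibility replaced by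
  the flow norms, `(‖AΨ‖² + ‖BΨ‖²)² ≤ (re ⟪Ψ, double commutator Ψ⟫ − μc)(‖G₊‖² + ‖G₋‖²)`.
-/

namespace Summit.AtomisticToContinuum.BoseEinsteinCondensation.Theorems

open scoped InnerProductSpace ComplexConjugate

variable {E F F' : Type*} [NormedAddCommGroup E] [InnerProductSpace ℂ E]
  [NormedAddCommGroup F] [InnerProductSpace ℂ F] [NormedAddCommGroup F'] [InnerProductSpace ℂ F']

/-- For `P = T† T` the form is a norm square: `re ⟪x, P x⟫ = ‖T x‖²`. -/
theorem re_inner_factorised_eq_norm_sq (T : E →ₗ[ℂ] F) (Tadj : F →ₗ[ℂ] E)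
    (hT : ∀ (x : E) (w : F), ⟪T x, w⟫_ℂ = ⟪x, Tadj w⟫_ℂ) (P : E →ₗ[ℂ] E)
    (hP : ∀ x, P x = Tadj (T x)) (x : E) : (⟪x, P x⟫_ℂ).re = ‖T x‖ ^ 2 := by
  rw [hP, ← hT, inner_self_eq_norm_sq_to_K]
  norm_cast

/-- **Flow bound, one-sided** (Thomson's principle, inequality half): if `P = T† T` and
`G` is a flow with `T† G = y`, then `‖y‖⁴ ≤ re ⟪y, P y⟫ · ‖G‖²`. -/
theorem norm_sq_sq_le_form_mul_flow (T : E →ₗ[ℂ] F) (Tadj : F →ₗ[ℂ] E)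
    (hT : ∀ (x : E) (w : F), ⟪T x, w⟫_ℂ = ⟪x, Tadj w⟫_ℂ) (P : E →ₗ[ℂ] E)
    (hP : ∀ x, P x = Tadj (T x)) (y : E) {G : F} (hG : Tadj G = y) :
    (‖y‖ ^ 2) ^ 2 ≤ (⟪y, P y⟫_ℂ).re * ‖G‖ ^ 2 := by
  have hform : (⟪y, P y⟫_ℂ).re = ‖T y‖ ^ 2 := re_inner_factorised_eq_norm_sq T Tadj hT P hP y
  have hyy : ‖y‖ ^ 2 = (⟪T y, G⟫_ℂ).re := by
    have : ⟪y, y⟫_ℂ = ⟪T y, G⟫_ℂ := by rw [hT, hG]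
    rw [← this, inner_self_eq_norm_sq_to_K]
    norm_cast
  have hcs : (⟪T y, G⟫_ℂ).re ≤ ‖T y‖ * ‖G‖ := by
    have h := re_inner_le_norm (𝕜 := ℂ) (T y) G
    simpa only [RCLike.re_to_complex] using h
  have h0 : 0 ≤ ‖y‖ ^ 2 := by positivity
  rw [hform]
  calc (‖y‖ ^ 2) ^ 2 ≤ (‖T y‖ * ‖G‖) ^ 2 := by
        rw [hyy] at h0 ⊢
        exact pow_le_pow_left₀ h0 hcs 2
    _ = ‖T y‖ ^ 2 * ‖G‖ ^ 2 := by ring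

/-- **Flow bound on the susceptibility itself**: if `P = T† T`, `P z = y` and `T† G = y`, then
`re ⟪z, y⟫ (= ⟪y, P⁻¹ y⟫) ≤ ‖G‖²`. -/
theorem re_inner_le_norm_sq_of_flow (T : E →ₗ[ℂ] F) (Tadj : F →ₗ[ℂ] E)
    (hT : ∀ (x : E) (w : F), ⟪T x, w⟫_ℂ = ⟪x, Tadj w⟫_ℂ) (P : E →ₗ[ℂ] E)
    (hP : ∀ x, P x = Tadj (T x)) {z y : E} (hz : P z = y) {G : F} (hG : Tadj G = y) :
    (⟪z, y⟫_ℂ).re ≤ ‖G‖ ^ 2 := by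
  have h1 : (⟪z, y⟫_ℂ).re = ‖T z‖ ^ 2 := by
    rw [← hz]
    exact re_inner_factorised_eq_norm_sq T Tadj hT P hP z
  have h2 : (⟪z, y⟫_ℂ).re = (⟪T z, G⟫_ℂ).re := by
    have : ⟪z, y⟫_ℂ = ⟪T z, G⟫_ℂ := by rw [← hG, ← hT]
    rw [this]
  have hcs : (⟪T z, G⟫_ℂ).re ≤ ‖T z‖ * ‖G‖ := by
    have h := re_inner_le_norm (𝕜 := ℂ) (T z) G
    simpa only [RCLike.re_to_complex] using h
  have hsq : ‖T z‖ ^ 2 ≤ ‖T z‖ * ‖G‖ := by rw [← h1, h2]; exact hcs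
  rw [h1]
  nlinarith [sq_nonneg (‖T z‖ - ‖G‖), norm_nonneg (T z), norm_nonneg G, hsq]

/-- **Occupation bound from flows** (paper §12.5): the setting of
`occupation_susceptibility_bound` — `H` symmetric with eigenvector `Ψ`, `B = A†`,
`‖BΨ‖² = ‖AΨ‖² + c`, shifted operators `P₊ = H − (e+μ)` on `BΨ` and `P₋ = H − (e−μ)` on `AΨ` at
the level of forms — but with `P± = T±† T±` factorised and the susceptibility replaced by the norms
of two flows `G±` with `T₊† G₊ = BΨ`, `T₋† G₋ = AΨ`:
`(‖AΨ‖² + ‖BΨ‖²)² ≤ (re ⟪Ψ, (A[H,B] − [H,B]A… ) Ψ⟫ − μ c) · (‖G₊‖² + ‖G₋‖²)`.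
No positivity hypothesis and no solution of `P z = y` is needed. -/
theorem occupation_flow_bound (H A B Pp Pm : E →ₗ[ℂ] E) (hH : H.IsSymmetric)
    (hAB : ∀ x y : E, ⟪A x, y⟫_ℂ = ⟪x, B y⟫_ℂ) {Ψ : E} {e μ c : ℝ} (hΨ : H Ψ = (e : ℂ) • Ψ)
    (hCCR : ‖B Ψ‖ ^ 2 = ‖A Ψ‖ ^ 2 + c)
    (hformp : (⟪B Ψ, Pp (B Ψ)⟫_ℂ).re = (⟪B Ψ, H (B Ψ)⟫_ℂ).re - (e + μ) * ‖B Ψ‖ ^ 2)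
    (hformm : (⟪A Ψ, Pm (A Ψ)⟫_ℂ).re = (⟪A Ψ, H (A Ψ)⟫_ℂ).re - (e - μ) * ‖A Ψ‖ ^ 2)
    (Tp : E →ₗ[ℂ] F) (Tpadj : F →ₗ[ℂ] E) (hTp : ∀ (x : E) (w : F), ⟪Tp x, w⟫_ℂ = ⟪x, Tpadj w⟫_ℂ)
    (hPp : ∀ x, Pp x = Tpadj (Tp x))
    (Tm : E →ₗ[ℂ] F') (Tmadj : F' →ₗ[ℂ] E) (hTm : ∀ (x : E) (w : F'), ⟪Tm x, w⟫_ℂ = ⟪x, Tmadj w⟫_ℂ)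
    (hPm : ∀ x, Pm x = Tmadj (Tm x))
    {Gp : F} (hGp : Tpadj Gp = B Ψ) {Gm : F'} (hGm : Tmadj Gm = A Ψ) :
    (‖A Ψ‖ ^ 2 + ‖B Ψ‖ ^ 2) ^ 2 ≤
      ((⟪Ψ, A (H (B Ψ)) - A (B (H Ψ)) - H (B (A Ψ)) + B (H (A Ψ))⟫_ℂ).re - μ * c)
        * (‖Gp‖ ^ 2 + ‖Gm‖ ^ 2) := by
  have hp := norm_sq_sq_le_form_mul_flow Tp Tpadj hTp Pp hPp (B Ψ) hGp
  have hm := norm_sq_sq_le_form_mul_flow Tm Tmadj hTm Pm hPm (A Ψ) hGm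
  have hbp : 0 ≤ (⟪B Ψ, Pp (B Ψ)⟫_ℂ).re := by
    rw [re_inner_factorised_eq_norm_sq Tp Tpadj hTp Pp hPp]; positivity
  have hbm : 0 ≤ (⟪A Ψ, Pm (A Ψ)⟫_ℂ).re := by
    rw [re_inner_factorised_eq_norm_sq Tm Tmadj hTm Pm hPm]; positivity
  have h := add_sq_le_add_mul_add (by positivity) (by positivity) hbp (by positivity) hbm
    (by positivity) hp hm
  have hm1 : (⟪B Ψ, Pp (B Ψ)⟫_ℂ).re + (⟪A Ψ, Pm (A Ψ)⟫_ℂ).re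
      = (⟪Ψ, A (H (B Ψ)) - A (B (H Ψ)) - H (B (A Ψ)) + B (H (A Ψ))⟫_ℂ).re - μ * c := by
    rw [re_inner_doubleCommutator_eq H A B hH hAB hΨ, hformp, hformm, hCCR]
    ring
  rw [add_comm (‖A Ψ‖ ^ 2), ← hm1]
  exact h

end Summit.AtomisticToContinuum.BoseEinsteinCondensation.Theorems
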